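import Literature.MathematicalPhysics.QuantumLattice.GrassmannWeightedEffectiveActionGradedTruncationPrescribedDB
import Literature.MathematicalPhysics.QuantumLattice.GrassmannWeightedCumulantKernelBoundOriented
import HarnessLib

/-!
# The truncated (non-linear) renormalisation-group step, GRADED, decay-WEIGHTED, with prescribed output SECTORS and ORIENTED tree lines

Topic `Literature/MathematicalPhysics/QuantumLattice`; the oriented twin of `GrassmannWeightedEffectiveActionGradedTruncationPrescribedDB`
(Benfatto–Giuliani–Mastropietro 2006, (2.13)–(2.14), (2.77)–(2.80), §3 (3.2)–(3.8), §2.8 (2.97)–(2.98), App. A4 (A4.8)): the graded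
terms come from `sum_wt_norm_kernel_cumulantOf_le_oriented_of_gramBounded` (levelled anchored norms, talking relation, oracle `Nφ`
over the readings of the anchored trees), the flat tail is the unoriented one (plain weighted anchored norms `Npl`).

* `prescribedBound_le_indicator_sum_gen` — the per-assignment numerics of `prescribedBound_le_indicator_sum` for an arbitrary
  nonnegative profile functional `X pf` in place of `∏_a N(δ_a, |pf⁻¹ a|)`;
* `sum_wt_norm_kernel_cumulantOf_le_graded_oriented_of_gramBounded` — the graded cumulant bound;
* `sum_wt_norm_kernel_effAction_sub_gaussConv_le_graded_oriented_of_gramBounded` — the graded truncated step.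

Everything is proved; no definition, no named fact.

## Sources

G. Benfatto, A. Giuliani, V. Mastropietro, Ann. Henri Poincaré 7 (2006) 809–898, (2.13)–(2.14), (2.77)–(2.80), §3 (3.2)–(3.8), §2.8,
App. A4 (A4.8) [`BenfattoGiulianiMastropietro2006`]; K. Gawȩdzki, A. Kupiainen, Comm. Math. Phys. 102 (1985) 1–30, §3
[`GawedzkiKupiainen1985`].
-/

noncomputable section

namespace Literature.MathematicalPhysics.QuantumLattice

open GrassmannAlgebra Finset Literature.Probability.LatticeModels Literature.Probability.LatticeModels.BattleFederbush
open scoped InnerProductSpace Nat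

universe u

variable {𝕜 : Type*} [RCLike 𝕜] {Γ : Type u} [Fintype Γ] [DecidableEq Γ] {n : ℕ} {wt : Finset Γ → ℝ} (C : Matrix Γ Γ 𝕜)
variable {Sec : Type*} [Fintype Sec] [DecidableEq Sec]

/-! ### One degree assignment: the numerics for an arbitrary profile functional -/

/-- **The per-assignment majorisation of the prescribed cumulant bound on the leg constraint** (twin of
`cumulantBound_le_indicator_prod`): for `r + 2(n−1) ≤ N_δ = Σ_a 2δ_a` and `λ_δ = 1/(α(N_δ + n))`, with the free count of the
unconstrained derivative steps `∏_{j∉J}(N_δ - j) ≤ N_δ^{r-|J|}`, the multiplicity of a landing profile `∏_{j∈J} 2δ_{pf j} = N_δ^{|J|}·w_φ`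
(`Σ_φ w_φ = 1` by `∏_{j∈J} Σ_a 2δ_a = N_δ^{|J|}`) and `N_δ^r/r! ≤ e^{N_δ}`, the prescribed bound of one assignment is at most
`κ^{-r} κ^{-2(n−1)} (n−1)! α^{n−1} eⁿ · Σ_φ w_φ ∏_a (e³κ)^{2δ_a} N(δ_a, |pf⁻¹ a|)` — an AVERAGE over the landing profiles, so that any
profile-wise majorant of `∏_a N(δ_a, |pf⁻¹ a|)` is a majorant of the whole. [cite: BenfattoGiulianiMastropietro2006, (2.77)-(2.80) and Lemma 2.6] -/
theorem prescribedBound_le_indicator_sum_gen {κ α : ℝ} (hκ : 0 < κ) (hα : 0 < α) (hn : 0 < n) (r : ℕ) (J : Finset (Fin r))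
    (δ : Fin n → ℕ) (X : (J → Fin n) → ℝ) (hX0 : ∀ pf, 0 ≤ X pf) (hle : r + 2 * (n - 1) ≤ ∑ a, 2 * δ a) :
    ((((r.factorial : ℝ))⁻¹ * ((∏ j ∈ univ.filter (fun j : Fin r => j ∉ J), ((∑ a, 2 * δ a) - (j : ℕ)) : ℕ) : ℝ)) *
          κ ^ ((∑ a, 2 * δ a) - (r + 2 * (n - 1))) *
          ∑ pf : J → Fin n, (∏ j, ((2 * δ (pf j) : ℕ) : ℝ)) * X pf) *
        (((α * ((∑ a, (2 * δ a : ℝ)) + n))⁻¹)⁻¹ ^ (n - 1) *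
          ∏ ℓ : Sym2 (Fin n), (1 + (α * ((∑ a, (2 * δ a : ℝ)) + n))⁻¹ * (α * (pairDeg (fun a => 2 * δ a) ℓ : ℝ)))) ≤
      (κ⁻¹ ^ r * κ⁻¹ ^ (2 * (n - 1)) * (((n - 1)! : ℝ) * α ^ (n - 1) * Real.exp n)) *
        ∑ pf : J → Fin n, ((∏ j, ((2 * δ (pf j) : ℕ) : ℝ)) / ((∑ a, 2 * δ a : ℕ) : ℝ) ^ J.card) *
          ((Real.exp 3 * κ) ^ (∑ a, 2 * δ a) * X pf) := by
  -- abbreviations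
  set Nδ : ℕ := ∑ a, 2 * δ a with hNδ
  set ext : ℕ := ∏ j ∈ univ.filter (fun j : Fin r => j ∉ J), (Nδ - (j : ℕ)) with hext
  set M : (J → Fin n) → ℝ := fun pf => ∏ j, ((2 * δ (pf j) : ℕ) : ℝ) with hM
  set wt : (J → Fin n) → ℝ := fun pf => M pf / (Nδ : ℝ) ^ J.card with hwt
  set tree : ℝ := ((α * ((∑ a, (2 * δ a : ℝ)) + n))⁻¹)⁻¹ ^ (n - 1) *
    ∏ ℓ : Sym2 (Fin n), (1 + (α * ((∑ a, (2 * δ a : ℝ)) + n))⁻¹ * (α * (pairDeg (fun a => 2 * δ a) ℓ : ℝ))) with htree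
  have hr : r ≤ Nδ := by omega
  have hJ : J.card ≤ r := by simpa using J.card_le_univ
  have hM0 : ∀ pf, 0 ≤ M pf := fun pf => prod_nonneg fun j _ => Nat.cast_nonneg _
  have hwt0 : ∀ pf, 0 ≤ wt pf := fun pf => div_nonneg (hM0 pf) (pow_nonneg (Nat.cast_nonneg _) _)
  -- the power of `Nδ` carried by the weights is never a harmful zero
  have hpow : ((Nδ : ℝ)) ^ J.card ≠ 0 := by
    by_cases hJ0 : J.card = 0
    · rw [hJ0, pow_zero]; exact one_ne_zero
    · have : 0 < r := lt_of_lt_of_le (Nat.pos_of_ne_zero hJ0) hJ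
      exact pow_ne_zero _ (by exact_mod_cast (by omega : Nδ ≠ 0))
  have hMw : ∀ pf, M pf = (Nδ : ℝ) ^ J.card * wt pf := fun pf => by
    rw [hwt]
    dsimp only
    rw [mul_div_cancel₀ _ hpow]
  -- the free count and the falling factorial: `(r!)⁻¹ ext Nδ^{|J|} ≤ Nδ^r / r! ≤ e^{Nδ}`
  have hext_le : (ext : ℝ) ≤ (Nδ : ℝ) ^ (r - J.card) := by
    have h1 : ext ≤ Nδ ^ (univ.filter (fun j : Fin r => j ∉ J)).card :=
      prod_le_pow_card _ _ _ fun j _ => Nat.sub_le _ _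
    have h2 : (univ.filter (fun j : Fin r => j ∉ J)).card = r - J.card := by
      rw [filter_not, filter_mem_eq_inter, univ_inter, card_univ_sdiff, Fintype.card_fin]
    rw [h2] at h1
    exact_mod_cast h1
  have hcount : ((r.factorial : ℝ))⁻¹ * (ext : ℝ) * (Nδ : ℝ) ^ J.card ≤ Real.exp Nδ := by
    have h1 : ((r.factorial : ℝ))⁻¹ * (ext : ℝ) * (Nδ : ℝ) ^ J.card ≤ ((r.factorial : ℝ))⁻¹ * (Nδ : ℝ) ^ r := by
      rw [mul_assoc]
      refine mul_le_mul_of_nonneg_left ?_ (inv_nonneg.2 (Nat.cast_nonneg _))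
      calc (ext : ℝ) * (Nδ : ℝ) ^ J.card ≤ (Nδ : ℝ) ^ (r - J.card) * (Nδ : ℝ) ^ J.card :=
            mul_le_mul_of_nonneg_right hext_le (pow_nonneg (Nat.cast_nonneg _) _)
        _ = (Nδ : ℝ) ^ r := by rw [← pow_add, Nat.sub_add_cancel hJ]
    have h2 : ((r.factorial : ℝ))⁻¹ * (Nδ : ℝ) ^ r ≤ Real.exp Nδ := by
      rw [inv_mul_eq_div]
      exact Real.pow_div_factorial_le_exp _ (Nat.cast_nonneg _) r
    exact h1.trans h2
  -- the powers of `κ`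
  have hκpow : κ ^ (Nδ - (r + 2 * (n - 1))) = κ ^ Nδ * (κ⁻¹ ^ r * κ⁻¹ ^ (2 * (n - 1))) := by
    rw [pow_sub₀ κ hκ.ne' hle, ← inv_pow, pow_add]
  -- the tree factor
  have hT := treeFactor_choice_le hn δ hα
  have hTnonneg : 0 ≤ tree := by
    have hs : 0 ≤ ∑ a, (2 * δ a : ℝ) := sum_nonneg fun a _ => by positivity
    exact mul_nonneg (by positivity) (prod_nonneg fun ℓ _ => by positivity)
  have hNδcast : (∑ a, (2 * δ a : ℝ)) = (Nδ : ℝ) := by rw [hNδ]; push_cast; rfl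
  -- assemble
  have hSw0 : 0 ≤ ∑ pf, wt pf * X pf := sum_nonneg fun pf _ => mul_nonneg (hwt0 pf) (hX0 pf)
  calc ((((r.factorial : ℝ))⁻¹ * (ext : ℝ)) * κ ^ (Nδ - (r + 2 * (n - 1))) * ∑ pf, M pf * X pf) * tree
      = ((((r.factorial : ℝ))⁻¹ * (ext : ℝ) * (Nδ : ℝ) ^ J.card) * (κ ^ Nδ * (κ⁻¹ ^ r * κ⁻¹ ^ (2 * (n - 1)))) *
          ∑ pf, wt pf * X pf) * tree := by
        rw [hκpow]
        simp only [hMw]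
        rw [show ∑ pf : J → Fin n, (Nδ : ℝ) ^ J.card * wt pf * X pf = (Nδ : ℝ) ^ J.card * ∑ pf, wt pf * X pf by
          rw [mul_sum]; exact sum_congr rfl fun pf _ => by ring]
        ring
    _ ≤ (Real.exp Nδ * (κ ^ Nδ * (κ⁻¹ ^ r * κ⁻¹ ^ (2 * (n - 1)))) * ∑ pf, wt pf * X pf) *
          (((n - 1)! : ℝ) * α ^ (n - 1) * Real.exp (2 * (∑ a, (2 * δ a : ℝ)) + n)) := by
        refine mul_le_mul (mul_le_mul_of_nonneg_right (mul_le_mul_of_nonneg_right hcount (by positivity)) hSw0) hT hTnonneg ?_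
        exact mul_nonneg (mul_nonneg (by positivity) (by positivity)) hSw0
    _ = (κ⁻¹ ^ r * κ⁻¹ ^ (2 * (n - 1)) * (((n - 1)! : ℝ) * α ^ (n - 1) * Real.exp n)) *
          ((Real.exp 3 * κ) ^ Nδ * ∑ pf, wt pf * X pf) := by
        rw [hNδcast]
        have hexp : Real.exp (2 * (Nδ : ℝ) + n) = Real.exp n * Real.exp 2 ^ Nδ := by
          rw [Real.exp_add, mul_comm, ← Real.exp_nat_mul, mul_comm (2 : ℝ) (Nδ : ℝ)]
        have hexp1 : Real.exp (Nδ : ℝ) = Real.exp 1 ^ Nδ := by rw [← Real.exp_nat_mul, mul_one]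
        have hexp3 : Real.exp 3 = Real.exp 1 * Real.exp 2 := by rw [← Real.exp_add]; norm_num
        rw [hexp, hexp1, hexp3, mul_pow, mul_pow]
        ring
    _ = (κ⁻¹ ^ r * κ⁻¹ ^ (2 * (n - 1)) * (((n - 1)! : ℝ) * α ^ (n - 1) * Real.exp n)) *
          ∑ pf : J → Fin n, wt pf * ((Real.exp 3 * κ) ^ Nδ * X pf) := by
        congr 1
        rw [mul_sum]
        refine sum_congr rfl fun pf _ => ?_
        ring


/-! ### The weighted graded cumulant bound with prescribed sectors, oriented -/

/-- **The graded, decay-weighted `L¹–L^∞` bound for the kernels of `𝓔ᵀ_C(V; n)` with prescribed output sectors and oriented tree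
lines** (`sum_wt_norm_kernel_cumulantOf_le_oriented_of_gramBounded` with `λ_δ = 1/(cα(N_δ+n))` and `prescribedBound_le_indicator_sum_gen`):
`Σ_{W : W_i = w, A_j(W_j)} wt(W) ‖kernel_r 𝓔ᵀ_C(V; n)(W)‖ ≤ n! · κ^{-r} κ^{-2(n−1)} (cα)^{n−1} eⁿ ·
Σ_{δ : r + 2(n−1) ≤ Σ 2δ_a} Σ_{pf : J → Fin n} w_φ (e³κ)^{N_δ} Nφ δ pf` (`w_φ = ∏_{j∈J} 2δ_{pf j}/N_δ^{|J|}`).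
[cite: BenfattoGiulianiMastropietro2006, (2.13)-(2.14), (2.77)-(2.80), §2.8 (2.97)-(2.98), App. A4 (A4.8)] -/
theorem sum_wt_norm_kernel_cumulantOf_le_graded_oriented_of_gramBounded (hwt : IsTreeWeight wt) {κ : ℝ} (hκ : 0 < κ)
    (hGB : IsGramBoundedR C κ)
    (sec : Γ → Sec) (ov : Sec → Sec → Prop) [DecidableRel ov] {c : ℕ} (hc1 : 1 ≤ c)
    (hov : ∀ σ' : Sec, (univ.filter fun σ : Sec => ov σ σ').card ≤ c)
    (hCov : ∀ X Y, C X Y ≠ 0 → ov (sec X) (sec Y) ∧ ov (sec Y) (sec X))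
    (degs : Finset ℕ) (K : (m' : ℕ) → (Fin (2 * m') → Γ) → 𝕜) {r : ℕ} (J : Finset (Fin r)) (A : Fin r → Γ → Bool)
    (σp : Fin r → Sec) (hA : ∀ j ∈ J, ∀ y, A j y = true → sec y = σp j)
    (N : ℕ → ℕ → ℝ) (hN0 : ∀ m' F, 0 ≤ N m' F)
    (hN : ∀ (m' : ℕ) (ρc : Fin (2 * m') → Option Sec) (t : Fin (2 * m')), ρc t = none → ∀ a : Γ,
      ∑ Y ∈ univ.filter (fun Y : Fin (2 * m') → Γ => Y t = a),
        (if ∀ j' σ, ρc j' = some σ → sec (Y j') = σ then ‖K m' Y‖ * wt (univ.image Y) else 0) ≤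
        N m' ((univ.filter fun j' : Fin (2 * m') => ρc j' ≠ none).card + 1))
    (hNsw : ∀ (m' : ℕ) (ρc : Fin (2 * m') → Option Sec) (t : Fin (2 * m')), ρc t = none →
      ∃ g : Sec → ℝ, (∀ σ, 0 ≤ g σ) ∧
      (∀ a : Γ, ∑ Y ∈ univ.filter (fun Y : Fin (2 * m') → Γ => Y t = a),
        (if ∀ j' σ, ρc j' = some σ → sec (Y j') = σ then ‖K m' Y‖ * wt (univ.image Y) else 0) ≤ g (sec a)) ∧
      ∑ σ, g σ ≤ N m' (univ.filter fun j' : Fin (2 * m') => ρc j' ≠ none).card)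
    (Nφ : (Fin n → ℕ) → (J → Fin n) → ℝ) (hNφ0 : ∀ δ pf, 0 ≤ Nφ δ pf)
    (hNφ : ∀ (δ : Fin n → ℕ) (b : Fin n) {k : ℕ} (s : Script b k), s.Valid → univ.image s.y = univ → ∀ pf : J → Fin n,
      ∃ o : Fin n → Bool, ∏ a, N (δ a) ((univ.filter fun j : J => pf j = a).card +
        swChildren s o a + if a = b ∨ o a = true then 1 else 0) ≤ Nφ δ pf)
    {α : ℝ} (hα : 0 < α) (hrow : ∀ X, ∑ Y, ‖C X Y‖ * wt {X, Y} ≤ α) (hcol : ∀ Y, ∑ X, ‖C X Y‖ * wt {X, Y} ≤ α)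
    (hn : 0 < n) (i : Fin r) (hi : i ∉ J) (w : Γ) :
    ∑ W ∈ univ.filter (fun W : Fin r → Γ => W i = w ∧ ∀ j ∈ J, A j (W j) = true), wt (univ.image W) *
        ‖kernel 𝕜 ((cumulantOf (fun k => evenGaussConv 𝕜 C (vertexOf 𝕜 degs K ^ k)) n : evenPart 𝕜 Γ) : GrassmannAlgebra 𝕜 Γ) r W‖ ≤
      (n ! : ℝ) * (κ⁻¹ ^ r * κ⁻¹ ^ (2 * (n - 1)) * ((c * α) ^ (n - 1) * Real.exp n)) *
        ∑ δ ∈ (Fintype.piFinset fun _ : Fin n => degs) with r + 2 * (n - 1) ≤ ∑ a, 2 * δ a,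
          ∑ pf : J → Fin n, ((∏ j, ((2 * δ (pf j) : ℕ) : ℝ)) / ((∑ a, 2 * δ a : ℕ) : ℝ) ^ J.card) *
            ((Real.exp 3 * κ) ^ (∑ a, 2 * δ a) * Nφ δ pf) := by
  have hcα : 0 < (c : ℝ) * α := mul_pos (by exact_mod_cast hc1) hα
  have h := sum_wt_norm_kernel_cumulantOf_le_oriented_of_gramBounded C hwt hκ.le hGB sec ov hc1 hov hCov degs K J A σp hA N hN0
    hN hNsw Nφ hNφ0 hNφ hα.le hrow hcol (fun δ => ((c * α) * ((∑ a, (2 * δ a : ℝ)) + n))⁻¹)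
    (fun δ => by
      have : 0 < (c * α) * ((∑ a, (2 * δ a : ℝ)) + n) :=
        mul_pos hcα (by have : (0 : ℝ) ≤ ∑ a, (2 * δ a : ℝ) := sum_nonneg fun a _ => by positivity
                        have hn' : (0 : ℝ) < n := by exact_mod_cast hn
                        linarith)
      exact inv_pos.2 this)
    hn i hi w
  refine h.trans ?_
  set cc : ℝ := κ⁻¹ ^ r * κ⁻¹ ^ (2 * (n - 1)) * (((n - 1)! : ℝ) * (c * α) ^ (n - 1) * Real.exp n) with hcc
  set G : (Fin n → ℕ) → ℝ := fun δ => ∑ pf : J → Fin n, ((∏ j, ((2 * δ (pf j) : ℕ) : ℝ)) / ((∑ a, 2 * δ a : ℕ) : ℝ) ^ J.card) *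
    ((Real.exp 3 * κ) ^ (∑ a, 2 * δ a) * Nφ δ pf) with hG
  rw [← sum_filter]
  calc (n : ℝ) * ∑ δ ∈ (Fintype.piFinset fun _ : Fin n => degs) with r + 2 * (n - 1) ≤ ∑ a, 2 * δ a,
          ((((r.factorial : ℝ))⁻¹ * ((∏ j ∈ univ.filter (fun j : Fin r => j ∉ J), ((∑ a, 2 * δ a) - (j : ℕ)) : ℕ) : ℝ)) *
              κ ^ ((∑ a, 2 * δ a) - (r + 2 * (n - 1))) *
              ∑ pf : J → Fin n, (∏ j, ((2 * δ (pf j) : ℕ) : ℝ)) * Nφ δ pf) *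
            ((((c * α) * ((∑ a, (2 * δ a : ℝ)) + n))⁻¹)⁻¹ ^ (n - 1) *
              ∏ ℓ : Sym2 (Fin n), (1 + ((c * α) * ((∑ a, (2 * δ a : ℝ)) + n))⁻¹ * ((c * α) * (pairDeg (fun a => 2 * δ a) ℓ : ℝ))))
      ≤ (n : ℝ) * ∑ δ ∈ (Fintype.piFinset fun _ : Fin n => degs) with r + 2 * (n - 1) ≤ ∑ a, 2 * δ a, cc * G δ :=
        mul_le_mul_of_nonneg_left (sum_le_sum fun δ hδ =>
          prescribedBound_le_indicator_sum_gen hκ hcα hn r J δ (Nφ δ) (hNφ0 δ) (mem_filter.1 hδ).2) (Nat.cast_nonneg n)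
    _ = (n ! : ℝ) * (κ⁻¹ ^ r * κ⁻¹ ^ (2 * (n - 1)) * ((c * α) ^ (n - 1) * Real.exp n)) *
          ∑ δ ∈ (Fintype.piFinset fun _ : Fin n => degs) with r + 2 * (n - 1) ≤ ∑ a, 2 * δ a, G δ := by
        rw [← mul_sum, hcc, ← Nat.mul_factorial_pred (Nat.pos_iff_ne_zero.1 hn), Nat.cast_mul]
        ring

/-! ### The weighted graded truncated step with prescribed sectors, oriented -/

/-- **The non-linear part of the renormalisation-group map, GRADED, decay-WEIGHTED, with prescribed output sectors and ORIENTED tree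
lines** (Benfatto–Giuliani–Mastropietro 2006, (2.13)–(2.14) with (2.77)–(2.80), §3, §2.8 and App. A4 (A4.8)): with the plain
`wt`-weighted anchored norms `Npl(m')` of `V` (tail: `‖V‖_h = Σ_{m'} (e²(κ+ρ))^{2m'} Npl(m')`, `θ = eα‖V‖_h/κ² < 1`) and the LEVELLED
ones `N(m', F)` (graded terms; `hN` full pin, `hNsw` position-only pin, any legs sector-prescribed), a talking relation with at most `c`
partners supporting `C`, prescriptions `A j` forcing the sectors `σp j`, and oracles `Nφ n δ pf` over the readings of the anchored
trees, for every `N₀ ≥ 2`, every degree `m ≥ 1`, one output label pinned and the output labels of the slots `j ∈ J` constrained to `A j`,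
`Σ_W wt(W) ‖kernel_m (effAction C V − e^{Δ_C} V)(W)‖ ≤
   Σ_{n=2}^{N₀−1} κ^{-m} κ^{-2(n−1)} (cα)^{n−1} eⁿ · Σ_{δ, m + 2(n−1) ≤ Σ 2δ_a} Σ_φ w_φ (e³κ)^{N_δ} Nφ n δ pf + ρ^{-m} e‖V‖_h θ^{N₀−1}/(1−θ)`.
[cite: BenfattoGiulianiMastropietro2006, (2.13)-(2.14), (2.77)-(2.80), §3 (3.2)-(3.8), §2.8 (2.97)-(2.98), App. A4 (A4.8)] -/
theorem sum_wt_norm_kernel_effAction_sub_gaussConv_le_graded_oriented_of_gramBounded (hwt : IsTreeWeight wt) {κ : ℝ} (hκ : 0 < κ)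
    (hGB : IsGramBoundedR C κ) (V : GrassmannAlgebra 𝕜 Γ) (hV : V ∈ evenPart 𝕜 Γ) (hV0 : constPart 𝕜 V = 0)
    (sec : Γ → Sec) (ov : Sec → Sec → Prop) [DecidableRel ov] {c : ℕ} (hc1 : 1 ≤ c)
    (hov : ∀ σ' : Sec, (univ.filter fun σ : Sec => ov σ σ').card ≤ c)
    (hCov : ∀ X Y, C X Y ≠ 0 → ov (sec X) (sec Y) ∧ ov (sec Y) (sec X))
    {m : ℕ} (J : Finset (Fin m)) (A : Fin m → Γ → Bool) (σp : Fin m → Sec) (hA : ∀ j ∈ J, ∀ y, A j y = true → sec y = σp j)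
    (Npl : ℕ → ℝ) (hNpl0 : ∀ m', 0 ≤ Npl m')
    (hNplain : ∀ (m' : ℕ) (j : Fin (2 * m')) (w : Γ),
      ∑ Y ∈ univ.filter (fun Y : Fin (2 * m') → Γ => Y j = w), ‖kernel 𝕜 V (2 * m') Y‖ * wt (univ.image Y) ≤ Npl m')
    (N : ℕ → ℕ → ℝ) (hN0 : ∀ m' F, 0 ≤ N m' F)
    (hN : ∀ (m' : ℕ) (ρc : Fin (2 * m') → Option Sec) (t : Fin (2 * m')), ρc t = none → ∀ a : Γ,
      ∑ Y ∈ univ.filter (fun Y : Fin (2 * m') → Γ => Y t = a),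
        (if ∀ j' σ, ρc j' = some σ → sec (Y j') = σ then ‖kernel 𝕜 V (2 * m') Y‖ * wt (univ.image Y) else 0) ≤
        N m' ((univ.filter fun j' : Fin (2 * m') => ρc j' ≠ none).card + 1))
    (hNsw : ∀ (m' : ℕ) (ρc : Fin (2 * m') → Option Sec) (t : Fin (2 * m')), ρc t = none →
      ∃ g : Sec → ℝ, (∀ σ, 0 ≤ g σ) ∧
      (∀ a : Γ, ∑ Y ∈ univ.filter (fun Y : Fin (2 * m') → Γ => Y t = a),
        (if ∀ j' σ, ρc j' = some σ → sec (Y j') = σ then ‖kernel 𝕜 V (2 * m') Y‖ * wt (univ.image Y) else 0) ≤ g (sec a)) ∧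
      ∑ σ, g σ ≤ N m' (univ.filter fun j' : Fin (2 * m') => ρc j' ≠ none).card)
    (Nφ : (n : ℕ) → (Fin n → ℕ) → (J → Fin n) → ℝ) (hNφ0 : ∀ n δ pf, 0 ≤ Nφ n δ pf)
    (hNφ : ∀ (n : ℕ) (δ : Fin n → ℕ) (b : Fin n) {k : ℕ} (s : Script b k), s.Valid → univ.image s.y = univ → ∀ pf : J → Fin n,
      ∃ o : Fin n → Bool, ∏ a, N (δ a) ((univ.filter fun j : J => pf j = a).card +
        swChildren s o a + if a = b ∨ o a = true then 1 else 0) ≤ Nφ n δ pf)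
    {α : ℝ} (hα : 0 < α) (hrow : ∀ X, ∑ Y, ‖C X Y‖ * wt {X, Y} ≤ α) (hcol : ∀ Y, ∑ X, ‖C X Y‖ * wt {X, Y} ≤ α) {ρ : ℝ} (hρ : 0 < ρ)
    (hθ : Real.exp 1 * α * normV Γ κ ρ Npl / κ ^ 2 < 1) {N₀ : ℕ} (hN₀ : 2 ≤ N₀) (hm : 0 < m) (i : Fin m) (hi : i ∉ J)
    (w : Γ) :
    ∑ W ∈ univ.filter (fun W : Fin m → Γ => W i = w ∧ ∀ j ∈ J, A j (W j) = true), wt (univ.image W) *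
        ‖kernel 𝕜 (effAction 𝕜 C V - gaussConv 𝕜 C V) m W‖ ≤
      ∑ n ∈ Ico 2 N₀, (κ⁻¹ ^ m * κ⁻¹ ^ (2 * (n - 1)) * ((c * α) ^ (n - 1) * Real.exp n)) *
          ∑ δ ∈ (Fintype.piFinset fun _ : Fin n => range (Fintype.card Γ / 2 + 1)) with m + 2 * (n - 1) ≤ ∑ a, 2 * δ a,
            ∑ pf : J → Fin n, ((∏ j, ((2 * δ (pf j) : ℕ) : ℝ)) / ((∑ a, 2 * δ a : ℕ) : ℝ) ^ J.card) *
              ((Real.exp 3 * κ) ^ (∑ a, 2 * δ a) * Nφ n δ pf) +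
        ρ⁻¹ ^ m * (Real.exp 1 * normV Γ κ ρ Npl) *
          (Real.exp 1 * α * normV Γ κ ρ Npl / κ ^ 2) ^ (N₀ - 1) / (1 - Real.exp 1 * α * normV Γ κ ρ Npl / κ ^ 2) := by
  -- notation (as in `sum_wt_norm_kernel_effAction_sub_gaussConv_le_graded_prescribed_of_gramBounded`)
  set X : evenPart 𝕜 Γ := ⟨-V, neg_mem hV⟩ with hX
  set degs : Finset ℕ := range (Fintype.card Γ / 2 + 1) with hdegs
  set K : (m' : ℕ) → (Fin (2 * m') → Γ) → 𝕜 := fun m' => kernel 𝕜 (-V) (2 * m') with hK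
  set Wset := univ.filter (fun W : Fin m → Γ => W i = w ∧ ∀ j ∈ J, A j (W j) = true) with hWset
  have hXv : vertexOf 𝕜 degs K = X := Subtype.ext (coe_vertexOf_kernel_eq 𝕜 X)
  have hKnorm : ∀ (m' : ℕ) (Y : Fin (2 * m') → Γ), ‖K m' Y‖ = ‖kernel 𝕜 V (2 * m') Y‖ := fun m' Y => by
    rw [hK]
    dsimp only
    rw [show -V = (-1 : 𝕜) • V from (neg_one_smul 𝕜 V).symm, kernel_smul, norm_mul, norm_neg, norm_one, one_mul]
  -- the levelled hypotheses for the kernels of `-V`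
  have hN' : ∀ (m' : ℕ) (ρc : Fin (2 * m') → Option Sec) (t : Fin (2 * m')), ρc t = none → ∀ a : Γ,
      ∑ Y ∈ univ.filter (fun Y : Fin (2 * m') → Γ => Y t = a),
        (if ∀ j' σ, ρc j' = some σ → sec (Y j') = σ then ‖K m' Y‖ * wt (univ.image Y) else 0) ≤
        N m' ((univ.filter fun j' : Fin (2 * m') => ρc j' ≠ none).card + 1) := by
    intro m' ρc t ht a
    simp only [hKnorm]
    exact hN m' ρc t ht a
  have hNsw' : ∀ (m' : ℕ) (ρc : Fin (2 * m') → Option Sec) (t : Fin (2 * m')), ρc t = none →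
      ∃ g : Sec → ℝ, (∀ σ, 0 ≤ g σ) ∧
      (∀ a : Γ, ∑ Y ∈ univ.filter (fun Y : Fin (2 * m') → Γ => Y t = a),
        (if ∀ j' σ, ρc j' = some σ → sec (Y j') = σ then ‖K m' Y‖ * wt (univ.image Y) else 0) ≤ g (sec a)) ∧
      ∑ σ, g σ ≤ N m' (univ.filter fun j' : Fin (2 * m') => ρc j' ≠ none).card := by
    intro m' ρc t ht
    simp only [hKnorm]
    exact hNsw m' ρc t ht
  set κs : ℕ → evenPart 𝕜 Γ := fun n => cumulantOf (fun k => evenGaussConv 𝕜 C (X ^ k)) n with hκs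
  have hκs_eq : ∀ n, κs n = cumulantOf (fun k => evenGaussConv 𝕜 C (vertexOf 𝕜 degs K ^ k)) n := fun n => by rw [hXv]
  -- the flat tail at order `N₀` (the constrained sum is part of the free one)
  obtain ⟨-, hbd⟩ := sum_wt_norm_kernel_effAction_add_sum_cumulant_le_of_gramBounded C hwt hκ hGB V hV hV0 Npl
    hNpl0 hNplain hα hrow hcol hρ hθ (n₀ := N₀) (by omega)
  have htail : ∑ W ∈ Wset, wt (univ.image W) *
      ‖kernel 𝕜 (effAction 𝕜 C V) m W + ∑ n ∈ Ico 1 N₀, ((n ! : 𝕜))⁻¹ *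
        kernel 𝕜 ((κs n : evenPart 𝕜 Γ) : GrassmannAlgebra 𝕜 Γ) m W‖ ≤
      ρ⁻¹ ^ m * (Real.exp 1 * normV Γ κ ρ Npl) *
        (Real.exp 1 * α * normV Γ κ ρ Npl / κ ^ 2) ^ (N₀ - 1) / (1 - Real.exp 1 * α * normV Γ κ ρ Npl / κ ^ 2) := by
    refine le_trans (sum_le_sum_of_subset_of_nonneg (fun W hW => ?_) fun _ _ _ => mul_nonneg (hwt.nonneg _) (norm_nonneg _))
      (hbd hm i w)
    rw [mem_filter] at hW ⊢
    exact ⟨hW.1, hW.2.1⟩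
  -- the graded bound of one cumulant term, with the `1/n!`
  set G : ℕ → ℝ := fun n => (κ⁻¹ ^ m * κ⁻¹ ^ (2 * (n - 1)) * ((c * α) ^ (n - 1) * Real.exp n)) *
      ∑ δ ∈ (Fintype.piFinset fun _ : Fin n => degs) with m + 2 * (n - 1) ≤ ∑ a, 2 * δ a,
        ∑ pf : J → Fin n, ((∏ j, ((2 * δ (pf j) : ℕ) : ℝ)) / ((∑ a, 2 * δ a : ℕ) : ℝ) ^ J.card) *
          ((Real.exp 3 * κ) ^ (∑ a, 2 * δ a) * Nφ n δ pf) with hG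
  have hterm : ∀ n, 0 < n → ∑ W ∈ Wset,
      wt (univ.image W) * ‖((n ! : 𝕜))⁻¹ * kernel 𝕜 ((κs n : evenPart 𝕜 Γ) : GrassmannAlgebra 𝕜 Γ) m W‖ ≤ G n := by
    intro n hn
    have h := sum_wt_norm_kernel_cumulantOf_le_graded_oriented_of_gramBounded C hwt hκ hGB sec ov hc1 hov hCov degs K J A σp hA
      N hN0 hN' hNsw' (Nφ n) (hNφ0 n) (hNφ n) hα hrow hcol hn i hi w
    rw [← hκs_eq] at h
    have hfac : (0 : ℝ) < n ! := by positivity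
    calc ∑ W ∈ Wset, wt (univ.image W) * ‖((n ! : 𝕜))⁻¹ * kernel 𝕜 ((κs n : evenPart 𝕜 Γ) : GrassmannAlgebra 𝕜 Γ) m W‖
        = (n ! : ℝ)⁻¹ * ∑ W ∈ Wset, wt (univ.image W) * ‖kernel 𝕜 ((κs n : evenPart 𝕜 Γ) : GrassmannAlgebra 𝕜 Γ) m W‖ := by
          rw [mul_sum]
          exact sum_congr rfl fun W _ => by rw [norm_mul, norm_inv, RCLike.norm_natCast]; ring
      _ ≤ (n ! : ℝ)⁻¹ * ((n ! : ℝ) * (κ⁻¹ ^ m * κ⁻¹ ^ (2 * (n - 1)) * ((c * α) ^ (n - 1) * Real.exp n)) *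
            ∑ δ ∈ (Fintype.piFinset fun _ : Fin n => degs) with m + 2 * (n - 1) ≤ ∑ a, 2 * δ a,
              ∑ pf : J → Fin n, ((∏ j, ((2 * δ (pf j) : ℕ) : ℝ)) / ((∑ a, 2 * δ a : ℕ) : ℝ) ^ J.card) *
                ((Real.exp 3 * κ) ^ (∑ a, 2 * δ a) * Nφ n δ pf)) :=
          mul_le_mul_of_nonneg_left h (by positivity)
      _ = G n := by rw [← mul_assoc, ← mul_assoc, inv_mul_cancel₀ hfac.ne', one_mul]
  -- the algebra: `kernel (effAction - e^{Δ}V) = [kernel effAction + Σ_{1 ≤ n < N₀} (n!)⁻¹ kernel κ_n] - Σ_{2 ≤ n < N₀} (n!)⁻¹ kernel κ_n`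
  have hone : ∀ W, ((1 ! : 𝕜))⁻¹ * kernel 𝕜 ((κs 1 : evenPart 𝕜 Γ) : GrassmannAlgebra 𝕜 Γ) m W = -kernel 𝕜 (gaussConv 𝕜 C V) m W := by
    intro W
    rw [hκs]
    dsimp only
    rw [Nat.factorial_one, Nat.cast_one, inv_one, one_mul, cumulantOf_one]
    simp only [pow_one, coe_evenGaussConv, hX, map_neg]
    rw [show -gaussConv 𝕜 C V = (-1 : 𝕜) • gaussConv 𝕜 C V from (neg_one_smul 𝕜 _).symm, kernel_smul]
    ring
  have hsplit : ∀ W, kernel 𝕜 (effAction 𝕜 C V - gaussConv 𝕜 C V) m W =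
      (kernel 𝕜 (effAction 𝕜 C V) m W + ∑ n ∈ Ico 1 N₀, ((n ! : 𝕜))⁻¹ * kernel 𝕜 ((κs n : evenPart 𝕜 Γ) : GrassmannAlgebra 𝕜 Γ) m W) -
        ∑ n ∈ Ico 2 N₀, ((n ! : 𝕜))⁻¹ * kernel 𝕜 ((κs n : evenPart 𝕜 Γ) : GrassmannAlgebra 𝕜 Γ) m W := by
    intro W
    rw [sum_eq_sum_Ico_succ_bot (by omega : 1 < N₀), show ((1 ! : 𝕜))⁻¹ * kernel 𝕜 ((κs 1 : evenPart 𝕜 Γ) : GrassmannAlgebra 𝕜 Γ) m W =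
      -kernel 𝕜 (gaussConv 𝕜 C V) m W from hone W,
      show effAction 𝕜 C V - gaussConv 𝕜 C V = effAction 𝕜 C V + (-1 : 𝕜) • gaussConv 𝕜 C V by rw [neg_one_smul, sub_eq_add_neg],
      kernel_add, kernel_smul]
    ring
  -- assemble
  calc ∑ W ∈ Wset, wt (univ.image W) * ‖kernel 𝕜 (effAction 𝕜 C V - gaussConv 𝕜 C V) m W‖
      ≤ ∑ W ∈ Wset,
          (wt (univ.image W) *
              ‖kernel 𝕜 (effAction 𝕜 C V) m W + ∑ n ∈ Ico 1 N₀, ((n ! : 𝕜))⁻¹ * kernel 𝕜 ((κs n : evenPart 𝕜 Γ) : GrassmannAlgebra 𝕜 Γ) m W‖ +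
            ∑ n ∈ Ico 2 N₀, wt (univ.image W) * ‖((n ! : 𝕜))⁻¹ * kernel 𝕜 ((κs n : evenPart 𝕜 Γ) : GrassmannAlgebra 𝕜 Γ) m W‖) :=
        sum_le_sum fun W _ => by
          rw [hsplit W, ← mul_sum, ← mul_add]
          exact mul_le_mul_of_nonneg_left ((norm_sub_le _ _).trans (add_le_add le_rfl (norm_sum_le _ _))) (hwt.nonneg _)
    _ = ∑ W ∈ Wset, wt (univ.image W) *
          ‖kernel 𝕜 (effAction 𝕜 C V) m W + ∑ n ∈ Ico 1 N₀, ((n ! : 𝕜))⁻¹ * kernel 𝕜 ((κs n : evenPart 𝕜 Γ) : GrassmannAlgebra 𝕜 Γ) m W‖ +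
          ∑ n ∈ Ico 2 N₀, ∑ W ∈ Wset,
            wt (univ.image W) * ‖((n ! : 𝕜))⁻¹ * kernel 𝕜 ((κs n : evenPart 𝕜 Γ) : GrassmannAlgebra 𝕜 Γ) m W‖ := by
        rw [sum_add_distrib, sum_comm]
    _ ≤ ρ⁻¹ ^ m * (Real.exp 1 * normV Γ κ ρ Npl) *
          (Real.exp 1 * α * normV Γ κ ρ Npl / κ ^ 2) ^ (N₀ - 1) / (1 - Real.exp 1 * α * normV Γ κ ρ Npl / κ ^ 2) +
          ∑ n ∈ Ico 2 N₀, G n :=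
        add_le_add htail (sum_le_sum fun n hn => hterm n (by have := (mem_Ico.1 hn).1; omega))
    _ = _ := by rw [hG, add_comm]

end Literature.MathematicalPhysics.QuantumLattice
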